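import Literature.Probability.LatticeModels.MedialInterfaceProofs
import Literature.Probability.Percolation.LatticeTraceGeometry
import Literature.Probability.Percolation.AnnulusCircuits
import Literature.Probability.Percolation.CrossingChains
import Literature.Probability.RandomPlanarGeometry.PlanarDomains
import Literature.Probability.RandomPlanarGeometry.JordanDomainInterior
import Literature.Probability.Percolation.BoxCrossingProofs
import Literature.Barriers.CriticalPhenomena.SupercriticalSAWSpaceFillingRefutation
import Summits.CriticalPhenomena.CardyFormulaZ2.Theorems.CardySelfRefinementLagHandOffKernelWalkToContact
import Summits.CriticalPhenomena.CardyFormulaZ2.Theorems.CardySelfRefinementLagHandOffKernelCycleFaces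
import Summits.CriticalPhenomena.CardyFormulaZ2.Theorems.CardySelfRefinementLagHandOffKernelInnerFaceClosure
import HarnessLib

/-!
# An open circuit around a boundary point forces an open contact with the wired arc: stub
`stub_kernel_circuitForcesContact` (K6) of line `hitting-tournament` for crux `LagHandOff`
(stmt-CriticalPhenomena-10268)

The deterministic core of seat c5's "contacts accumulate" lemma for critical bond percolation
near the wired arc `A` of a discretised Jordan domain `D` (admissible discrete Dobrushin data
`E` with `E.Ω = D.carrier`, mesh `δ = E.δ > 0`).  Let `ω` contain an open circuit of the square
annulus `v + A(l)` around a lattice point `v` (`openCircuitAroundAt v l`,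
`Literature/Probability/Percolation/LatticeTraceGeometry.lean`) such that the boundary curve
`∂D` has a point within `(l + 1) δ` of the mesh point `δ v` and a point farther than `3√2 l δ`
from it, and such that no site of the discrete arc `B` lies in `v + B(3l)`.  Then every
`ω°`-open path — `ω`-open edges of `Ω_δ` through sites off both discrete arcs — from a site `x`
near `v` to a site `y` far from `v` picks up, inside the annulus, a non-arc site `u` joined to
`x` by such a path and carrying an `ω`-OPEN edge `{u, u'}` of `Ω_δ` into the discrete arc `A`.

Proof.

1. The connection `x ↔ y` is witnessed by an open lattice walk `π` inside `Ω_δ ∖ arcs`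
   (`exists_walk_of_mem_openConnIn`); its mesh trace is preconnected, starts near `δ v` and
   ends far from it, so it meets the mesh trace of the circuit
   (`EnclosesPoint.inter_meshTrace_nonempty`), hence shares a vertex `z` with the circuit
   (`exists_mem_support_of_meshTrace_inter_nonempty`).
2. Rotate the circuit to start at `z` and walk it (`stub_kernel_walkToContact`, K2).  If it
   meets an arc site, the first contact edge `{u, u'}` is the answer: `u'` is not a `B`-site
   (it lies in `v + A(l) ⊆ v + B(3l)`), and `x ↔ z` along `π`, `z ↔ u` along the circuit.
3. Otherwise every circuit vertex lies in `Ω_δ` off the discrete boundary, so every face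
   cornered at a circuit vertex is inner (`stub_kernel_cycle_off_zdBoundary_faces_inner`, K3)
   and its closed mesh square lies in `closure D` (`stub_kernel_innerFace_subset_closure`, K4).
   The four squares around a circuit vertex `a` cover the ball of radius `δ` about `δ a`
   (`ball_meshPoint_subset_closure`), and every point of a mesh edge of the circuit is within
   `δ` of an endpoint, so the mesh trace of the circuit lies in `interior (closure D)`
   (`meshTrace_subset_interior`).
4. But `∂D = range D.boundary` is preconnected and joins the inside of the circuit to far away,
   so it meets the circuit's mesh trace at a point which is then an interior point of
   `closure D` on `∂D` — impossible, since every point of `∂D` is a limit of exterior points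
   (`JordanDomain.frontier_subset_closure_exterior` fed with `JordanCurveTheorem_holds`).

Only the three landed bricks K2–K4, `LatticeTraceGeometry.lean`, `CrossingChains.lean`
(`isPreconnected_meshTrace`, `meshPoint_mem_meshTrace_of_mem_support`), `PlanarDuality.lean`
(`exists_walk_of_mem_openConnIn`, `mem_openConnIn_of_mem_support`, `openConnIn_trans`),
`JordanDomainInterior.lean` / `PlanarDomainsTopology.lean`, the mesh-edge length
`SupercriticalSAW.dist_meshPoint_of_zdGraph_adj`
(`Literature/Barriers/CriticalPhenomena/SupercriticalSAWSpaceFillingRefutation.lean`) and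
Mathlib's walk API (`Walk.rotate`, `mem_support_rotate_iff`, `rotate_edges`) are used.  Helpers
live in the sub-namespace `KernelCircuitContact`.
-/

noncomputable section

open Set Metric MeasureTheory
open Literature.Probability.Percolation Literature.Probability.LatticeModels
open Literature.Probability.RandomPlanarGeometry

namespace Summit.CriticalPhenomena.CardyFormulaZ2.Cruxes.LagHandOff.HittingTournament

namespace KernelCircuitContact

/-! ### Mesh squares around a vertex all of whose faces are inner -/

/-- A real number within `δ` of `δ c` (`c : ℤ`) lies in the closed mesh interval
`[δ m, δ (m + 1)]` for `m = c` or `m = c - 1`. -/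
theorem exists_int_of_abs_sub_lt {δ t : ℝ} {c : ℤ} (h : |t - δ * c| < δ) :
    ∃ m : ℤ, (c = m ∨ c = m + 1) ∧ δ * (m : ℝ) ≤ t ∧ t ≤ δ * ((m : ℝ) + 1) := by
  obtain ⟨h1, h2⟩ := abs_lt.1 h
  by_cases hc : δ * (c : ℝ) ≤ t
  · exact ⟨c, Or.inl rfl, hc, by linarith⟩
  · refine ⟨c - 1, Or.inr (by ring), ?_, ?_⟩ <;> push_cast <;> linarith

/-- **The ball of radius `δ` about a vertex with four inner faces lies in `closure D`.** If every
face cornered at the site `a` is an inner face of the discretisation of the Jordan domain `D`,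
then `ball (δ a) δ ⊆ closure D`: a point of the ball lies in the closed mesh square of one of the
four faces cornered at `a`, which lies in `closure D` (`stub_kernel_innerFace_subset_closure`). -/
theorem ball_meshPoint_subset_closure (D : JordanDomain) {E : DiscreteDobrushin}
    (hΩ : E.Ω = D.carrier) (hδ : 0 < E.δ) {a : Site 2}
    (ha : ∀ f : Site 2, IsCorner a f → E.IsInnerFace f) :
    ball (meshPoint E.δ a) E.δ ⊆ closure D.carrier := by
  intro z hz
  rw [mem_ball, Complex.dist_eq] at hz
  have hre : |z.re - E.δ * (a 0 : ℝ)| < E.δ :=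
    lt_of_le_of_lt (by simpa using Complex.abs_re_le_norm (z - meshPoint E.δ a)) hz
  have him : |z.im - E.δ * (a 1 : ℝ)| < E.δ :=
    lt_of_le_of_lt (by simpa using Complex.abs_im_le_norm (z - meshPoint E.δ a)) hz
  obtain ⟨m₀, h₀, h₀l, h₀u⟩ := exists_int_of_abs_sub_lt hre
  obtain ⟨m₁, h₁, h₁l, h₁u⟩ := exists_int_of_abs_sub_lt him
  have hf : IsCorner a ![m₀, m₁] :=
    (KernelCycleFaces.isCorner_iff_coord a _).2 ⟨by simpa using h₀, by simpa using h₁⟩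
  exact stub_kernel_innerFace_subset_closure D E hΩ hδ _ (ha _ hf) z (by simpa using h₀l)
    (by simpa using h₀u) (by simpa using h₁l) (by simpa using h₁u)

/-- **The mesh trace of a walk with inner faces at all its vertices lies in
`interior (closure D)`.** Every point of a closed mesh edge `[δ a, δ b]` of the walk is within
distance `< δ` of `δ a` or of `δ b` (the edge has length `δ`,
`SupercriticalSAW.dist_meshPoint_of_zdGraph_adj`), hence in one of the two open
balls of radius `δ` about them, both inside `closure D` (`ball_meshPoint_subset_closure`). -/
theorem meshTrace_subset_interior (D : JordanDomain) {E : DiscreteDobrushin}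
    (hΩ : E.Ω = D.carrier) (hδ : 0 < E.δ) {u₀ t₀ : Site 2} {w : (zdGraph 2).Walk u₀ t₀}
    (hin : ∀ x ∈ w.support, ∀ f : Site 2, IsCorner x f → E.IsInnerFace f) :
    meshTrace E.δ w ⊆ interior (closure D.carrier) := by
  intro p hp
  obtain ⟨e, he, hpe⟩ := mem_meshTrace_iff.1 hp
  induction e using Sym2.ind with
  | h a b =>
    rw [← segment_meshPoint_eq_image] at hpe
    have hball : ∀ c ∈ w.support, dist p (meshPoint E.δ c) < E.δ →
        p ∈ interior (closure D.carrier) := fun c hc hd =>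
      mem_interior.2 ⟨_, ball_meshPoint_subset_closure D hΩ hδ (hin c hc), isOpen_ball,
        mem_ball.2 hd⟩
    have hsum := dist_add_dist_of_mem_segment hpe
    rw [Literature.Barriers.CriticalPhenomena.SupercriticalSAW.dist_meshPoint_of_zdGraph_adj hδ.le
      (w.adj_of_mem_edges he)] at hsum
    by_cases h : dist p (meshPoint E.δ b) < E.δ
    · exact hball b (w.snd_mem_support_of_mem_edges he) h
    · refine hball a (w.fst_mem_support_of_mem_edges he) ?_
      rw [dist_comm]
      push Not at h
      linarith

end KernelCircuitContact

open KernelCircuitContact in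
/-- **K6 `stub_kernel_circuitForcesContact`.** An `ω`-open circuit of the square annulus
`v + A(l)` around a lattice point `v` whose `(l + 1) δ`-neighbourhood meets `∂D` (and with a
point of `∂D` farther than `3√2 l δ`, and no discrete-`B` site in `v + B(3l)`) forces every
`ω°`-open path — `ω`-open `Ω_δ`-edges through sites off both discrete arcs — from near `v` to far
from `v` to pick up an OPEN contact edge `{u, u'}` into the discrete arc `A` at a non-arc site
`u` of the annulus joined to the start of the path.  The path meets the circuit at a vertex `z`
(preconnected mesh traces meet, and traces of lattice walks meet only at vertices); walking the
circuit from `z` (K2) either produces the contact edge, or shows that all circuit vertices are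
off the discrete boundary, whence (K3, K4) the circuit's mesh trace lies in
`interior (closure D)` — absurd, because the preconnected boundary curve `∂D` also crosses the
circuit and no point of `∂D` is interior to `closure D` (Jordan curve theorem). -/
theorem stub_kernel_circuitForcesContact :
    ∀ (D : JordanDomain) (E : DiscreteDobrushin), E.Ω = D.carrier → E.IsZdAdmissible → 0 < E.δ →
      ∀ (ω : BondConfig (Site 2)) (v : Site 2) (l : ℕ), 1 ≤ l → ω ∈ openCircuitAroundAt v l →
      (∃ q ∈ frontier D.carrier, dist q (meshPoint E.δ v) < ((l : ℝ) + 1) * E.δ) →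
      (∃ q ∈ frontier D.carrier, 3 * Real.sqrt 2 * l * E.δ < dist q (meshPoint E.δ v)) →
      (∀ b ∈ E.zdArcB, b - v ∉ (box 2 (3 * l) : Finset (Site 2))) →
      ∀ (x y : Site 2), dist (meshPoint E.δ x) (meshPoint E.δ v) < ((l : ℝ) + 1) * E.δ →
        3 * Real.sqrt 2 * l * E.δ < dist (meshPoint E.δ y) (meshPoint E.δ v) →
        (ω ∩ (discreteDomainGraph E.Ω E.δ).edgeSet) ∈
          openConnIn (meshDomain E.Ω E.δ \ (E.zdArcA ∪ E.zdArcB)) x y →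
        ∃ u u' : Site 2, u' ∈ E.zdArcA ∧ u ∉ E.zdArcA ∪ E.zdArcB ∧ s(u, u') ∈ ω ∧
          s(u, u') ∈ (discreteDomainGraph E.Ω E.δ).edgeSet ∧
          u - v ∈ (annulus 2 l (3 * l) : Finset (Site 2)) ∧
          (ω ∩ (discreteDomainGraph E.Ω E.δ).edgeSet) ∈
            openConnIn (meshDomain E.Ω E.δ \ (E.zdArcA ∪ E.zdArcB)) x u := by
  intro D E hΩ hE hδ ω v l hl hcirc hnear hfar hB x y hx hy hconn
  obtain ⟨u₀, w, hc, hs, hωe, henc⟩ := hcirc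
  -- (1) an `ω°`-open lattice walk `π` from `x` to `y` inside `Ω_δ ∖ arcs`
  have hω' : ω ∩ (discreteDomainGraph E.Ω E.δ).edgeSet ⊆ (zdGraph 2).edgeSet := fun e he =>
    SimpleGraph.edgeSet_subset_edgeSet.2
      ((discreteDomainGraph_le_meshGraph E.Ω E.δ).trans (meshGraph_le_zdGraph E.Ω E.δ)) he.2
  obtain ⟨π, hπS, hπω⟩ := exists_walk_of_mem_openConnIn hω' hconn
  -- `x ≠ y` (near versus far), so `π` is non-trivial and its mesh trace contains `δ x`, `δ y`
  have hxy : x ≠ y := by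
    rintro rfl
    have h3 := hy.trans hx
    have h4 : 0 < (l : ℝ) * E.δ := by positivity
    have h5 := mul_lt_mul_of_pos_right Real.one_lt_sqrt_two h4
    have h6 : (1 : ℝ) ≤ l := by exact_mod_cast hl
    nlinarith
  have hπn : ¬ π.Nil := SimpleGraph.Walk.not_nil_of_ne hxy
  -- (2) the walk meets the circuit at a common vertex `z`
  obtain ⟨z, hzπ, hzw⟩ := exists_mem_support_of_meshTrace_inter_nonempty hδ.ne'
    (henc.inter_meshTrace_nonempty hδ hs (isPreconnected_meshTrace E.δ π)
      (meshPoint_mem_meshTrace_of_mem_support hπn π.start_mem_support) hx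
      (meshPoint_mem_meshTrace_of_mem_support hπn π.end_mem_support) hy)
  obtain ⟨hzD, hzA⟩ := hπS z hzπ
  -- (3) walk the circuit, rotated to start at `z`
  have hrot : ∀ e ∈ (w.rotate z hzw).edges, e ∈ ω := fun e he =>
    hωe e ((w.rotate_edges z hzw).mem_iff.1 he)
  rcases stub_kernel_walkToContact E hE ω z z (w.rotate z hzw) hrot hzD hzA with
    ⟨hsupp, -⟩ | ⟨u, u', hu, hu', hu'A, huA, huu'ω, huu'E, hzu⟩
  · -- no contact: all circuit vertices are off the discrete boundary — contradiction
    exfalso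
    have hw' : ∀ a ∈ w.support, a ∈ meshDomain E.Ω E.δ ∧ a ∉ E.zdBoundary := fun a ha =>
      hsupp a ((SimpleGraph.Walk.mem_support_rotate_iff w z hzw).2 ha)
    have hin := stub_kernel_cycle_off_zdBoundary_faces_inner E u₀ w hc hw'
    have hF : IsPreconnected (frontier D.carrier) := by
      rw [← D.range_boundary]
      exact isPreconnected_range D.continuous_boundary
    obtain ⟨q₁, hq₁, hq₁d⟩ := hnear
    obtain ⟨q₂, hq₂, hq₂d⟩ := hfar
    obtain ⟨q, hqF, hqT⟩ := henc.inter_meshTrace_nonempty hδ hs hF hq₁ hq₁d hq₂ hq₂d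
    have hqi := meshTrace_subset_interior D hΩ hδ hin hqT
    have hqe := D.frontier_subset_closure_exterior
      Literature.Topology.PlaneTopology.JordanCurveTheorem_holds hqF
    rw [mem_closure_iff_nhds] at hqe
    obtain ⟨r, hri, hre⟩ := hqe _ (isOpen_interior.mem_nhds hqi)
    exact hre (interior_subset hri)
  · -- first contact edge `{u, u'}` along the circuit
    have huw : u ∈ w.support := (SimpleGraph.Walk.mem_support_rotate_iff w z hzw).1 hu
    have hu'w : u' ∈ w.support := (SimpleGraph.Walk.mem_support_rotate_iff w z hzw).1 hu'
    refine ⟨u, u', ?_, huA, huu'ω, huu'E, hs u huw, ?_⟩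
    · rcases hu'A with h | h
      · exact h
      · exact absurd (mem_annulus.1 (hs u' hu'w)).1 (hB u' h)
    · obtain ⟨hz1, hu1, hr⟩ := hzu
      exact PlanarDuality.openConnIn_trans (mem_openConnIn_of_mem_support π hπS hπω hzπ)
        ⟨hz1.1, hu1.1, hr.map (SimpleGraph.induceHomOfLE
          (G := openGraph (ω ∩ (discreteDomainGraph E.Ω E.δ).edgeSet))
          Set.inter_subset_left).toHom⟩

end Summit.CriticalPhenomena.CardyFormulaZ2.Cruxes.LagHandOff.HittingTournament

end
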